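import Literature.Geometry.Kaehler.AnalyticSetSemipurity
import Literature.AlgebraicTopology.SingularHomology.TripleSequence
import HarnessLib

/-!
# Vanishing of the local homology at an analytic set and at its closed subsets

Topic `Literature/Geometry/Kaehler`. Sequel to `AnalyticSetSemipurity.lean` (for `T` analytic in the
second countable complex manifold `N` with regular points of codimension `≥ c₀` and `W ⊆ N` open,
`H_q(W ∖ T) → H_q(W)` is onto for `q < 2c₀` and one-to-one for `q + 1 < 2c₀`). In the language of
local homology `H_j(X | K) = H_j(X, X ∖ K)` (`Literature.AlgebraicTopology.SingularHomology.localHomologyOfSet`):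

* `IsAnalyticSet.isZero_localHomologyOfSet_preimage` — `H_j(W | T) = 0` for `1 ≤ j < 2c₀` and every
  open `W` (long exact sequence of the pair, `isZero_relativeSingularHomology_succ_of_epi_of_mono`);
* `IsAnalyticSet.isZero_localHomologyOfSet` — the case `W = N`;
* `IsAnalyticSet.isZero_localHomologyOfSet_of_subset` — **`H_j(N | Z) = 0` for `2 ≤ j < 2c₀` and
  every CLOSED SUBSET `Z ⊆ T`** (e.g. the bad set `Sg` of a nearly holomorphic cycle support, which
  is only required to lie in an analytic set of codimension `≥ p + 1`): exact sequence of the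
  triple `(N, N ∖ Z, N ∖ T)` (`relativeSingularHomology.triple_exact₃`), whose outer terms are local
  homology groups of `T` in `N` and in the open `N ∖ Z`.

This is Voisin I, §11.1.2, Lemma 11.13 ("`Hʲ(X, X − Y) = 0` for `j < 2k`") for analytic `Y` and
its closed subsets; step (iii) of "the classes supported on a nearly holomorphic cycle support
form a line" (threshold lemma of route *HolomorphicityRate*, Hodge summit). Theorems only.

## References

* C. Voisin, *Hodge Theory and Complex Algebraic Geometry I* (2002), §11.1.2 Lemma 11.13. [VoisinHodgeI2002]
* A. Hatcher, *Algebraic Topology* (2002), §2.1, p. 118 (exact sequence of a triple). [HatcherAT2002]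
-/

noncomputable section

open scoped Manifold ContDiff Topology
open Set TopologicalSpace Function
open Literature.AlgebraicTopology.SingularHomology

universe v

namespace Literature.Geometry.Kaehler

variable (R : Type v) [CommRing R] (M : Type v) [AddCommGroup M] [Module R M]
variable {E : Type} [NormedAddCommGroup E] [NormedSpace ℂ E] [FiniteDimensional ℂ E]
  {N : Type} [TopologicalSpace N] [ChartedSpace E N] [IsManifold 𝓘(ℂ, E) 1 N]
  [SecondCountableTopology N]

/-! ### Vanishing of the local homology at an analytic set and at its closed subsets -/

section LocalHomology

open CategoryTheory CategoryTheory.Limits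

variable {R M}

omit [FiniteDimensional ℂ E] [IsManifold 𝓘(ℂ, E) 1 N] [ChartedSpace E N] [SecondCountableTopology N] in
/-- From the inclusion `W ∖ T ↪ W` (subsets of `N`) to the inclusion of the complement of
`T ∩ W` in the subspace `W`: onto / one-to-one transfer along the tautological homeomorphism.
[folklore] -/
theorem surjective_injective_map_compl_preimage_iff (W T : Set N) (q : ℕ) :
    (Function.Surjective (singularHomology.map R M
        (subsetIncl (Subtype.val ⁻¹' T : Set ↥W)ᶜ) q) ↔
      Function.Surjective
        (singularHomology.map R M (subsetInclusion (sdiff_subset : W \ T ⊆ W)) q)) ∧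
    (Function.Injective (singularHomology.map R M
        (subsetIncl (Subtype.val ⁻¹' T : Set ↥W)ᶜ) q) ↔
      Function.Injective
        (singularHomology.map R M (subsetInclusion (sdiff_subset : W \ T ⊆ W)) q)) := by
  let eA : ↥(Subtype.val ⁻¹' T : Set ↥W)ᶜ ≃ₜ ↥(W \ T) :=
    { toFun := fun x ↦ ⟨x.1.1, x.1.2, x.2⟩
      invFun := fun y ↦ ⟨⟨y.1, y.2.1⟩, y.2.2⟩
      left_inv := fun _ ↦ rfl
      right_inv := fun _ ↦ rfl
      continuous_toFun := by fun_prop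
      continuous_invFun := by fun_prop }
  have hc : ((Homeomorph.refl ↥W : ↥W ≃ₜ ↥W) : C(↥W, ↥W)).comp
      (subsetIncl (Subtype.val ⁻¹' T : Set ↥W)ᶜ) =
      (subsetInclusion (sdiff_subset : W \ T ⊆ W)).comp
        (eA : C(↥(Subtype.val ⁻¹' T : Set ↥W)ᶜ, ↥(W \ T))) :=
    ContinuousMap.ext fun _ ↦ rfl
  exact ⟨surjective_map_iff_of_homeomorph R M _ _ _ _ hc q,
    injective_map_iff_of_homeomorph R M _ _ _ _ hc q⟩

variable (R M)

/-- **`H_j(W | T; M) = 0` for `1 ≤ j < 2c₀` and every open `W`**, `T` analytic with regular points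
of codimension `≥ c₀`: the long exact sequence of the pair turns onto-in-degree-`j` and
one-to-one-in-degree-`j - 1` (`IsAnalyticSet.surjective_injective_map_diff`) into the vanishing of
the relative group (`isZero_relativeSingularHomology_succ_of_epi_of_mono`).
[cite: VoisinHodgeI2002, §11.1.2 Lemma 11.13 (Hʲ(X, X − Y) = 0, j < 2k)] -/
theorem IsAnalyticSet.isZero_localHomologyOfSet_preimage {T : Set N} (hT : IsAnalyticSet 𝓘(ℂ, E) T)
    {c₀ : ℕ} (hc₀ : ∀ z c, z ∈ T → IsRegularPointOfCodim 𝓘(ℂ, E) T c z → c₀ ≤ c)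
    {W : Set N} (hW : IsOpen W) {j : ℕ} (hj1 : 1 ≤ j) (hj : j < 2 * c₀) :
    IsZero (localHomologyOfSet R M (↥W) (Subtype.val ⁻¹' T) j) := by
  obtain ⟨i, rfl⟩ : ∃ i, j = i + 1 := ⟨j - 1, by omega⟩
  obtain ⟨hs, hi⟩ := hT.surjective_injective_map_diff R M hc₀ hW
  have hs' := (surjective_injective_map_compl_preimage_iff (R := R) (M := M) W T (i + 1)).1.2 (hs (i + 1) hj)
  have hi' := (surjective_injective_map_compl_preimage_iff (R := R) (M := M) W T i).2.2 (hi i (by omega))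
  haveI : Epi (singularHomology.map R M (subsetIncl (Subtype.val ⁻¹' T : Set ↥W)ᶜ) (i + 1)) :=
    (ModuleCat.epi_iff_surjective _).2 hs'
  haveI : Mono (singularHomology.map R M (subsetIncl (Subtype.val ⁻¹' T : Set ↥W)ᶜ) i) :=
    (ModuleCat.mono_iff_injective _).2 hi'
  exact isZero_relativeSingularHomology_succ_of_epi_of_mono R M (Subtype.val ⁻¹' T : Set ↥W)ᶜ i

/-- **`H_j(N | T; M) = 0` for `1 ≤ j < 2c₀`** (the whole manifold), `T` analytic with regular points
of codimension `≥ c₀`. [cite: VoisinHodgeI2002, §11.1.2 Lemma 11.13] -/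
theorem IsAnalyticSet.isZero_localHomologyOfSet {T : Set N} (hT : IsAnalyticSet 𝓘(ℂ, E) T)
    {c₀ : ℕ} (hc₀ : ∀ z c, z ∈ T → IsRegularPointOfCodim 𝓘(ℂ, E) T c z → c₀ ≤ c)
    {j : ℕ} (hj1 : 1 ≤ j) (hj : j < 2 * c₀) :
    IsZero (localHomologyOfSet R M N T j) := by
  obtain ⟨i, rfl⟩ : ∃ i, j = i + 1 := ⟨j - 1, by omega⟩
  obtain ⟨hs, hi⟩ := hT.surjective_injective_map_compl R M hc₀
  haveI : Epi (singularHomology.map R M (subsetIncl Tᶜ) (i + 1)) :=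
    (ModuleCat.epi_iff_surjective _).2 (hs (i + 1) hj)
  haveI : Mono (singularHomology.map R M (subsetIncl Tᶜ) i) :=
    (ModuleCat.mono_iff_injective _).2 (hi i (by omega))
  exact isZero_relativeSingularHomology_succ_of_epi_of_mono R M Tᶜ i

/-- **`H_j(N | Z; M) = 0` for `2 ≤ j < 2c₀` and EVERY CLOSED SUBSET `Z` of an analytic set `T` with
regular points of codimension `≥ c₀`** (e.g. the bad set of a nearly holomorphic cycle support):
in the long exact sequence of the triple `(N, N ∖ Z, N ∖ T)`,
`H_j(N, N ∖ T) → H_j(N, N ∖ Z) → H_{j-1}(N ∖ Z, N ∖ T)`, the left group vanishes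
(`IsAnalyticSet.isZero_localHomologyOfSet`) and so does the right one, which is the local homology
of `T` in the OPEN subspace `N ∖ Z` (`IsAnalyticSet.isZero_localHomologyOfSet_preimage`).
[cite: VoisinHodgeI2002, §11.1.2 Lemma 11.13] [cite: HatcherAT2002, §2.1, p. 118 (exact sequence of a triple)] -/
theorem IsAnalyticSet.isZero_localHomologyOfSet_of_subset {T : Set N} (hT : IsAnalyticSet 𝓘(ℂ, E) T)
    {c₀ : ℕ} (hc₀ : ∀ z c, z ∈ T → IsRegularPointOfCodim 𝓘(ℂ, E) T c z → c₀ ≤ c)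
    {Z : Set N} (hZ : IsClosed Z) (hZT : Z ⊆ T) {j : ℕ} (hj2 : 2 ≤ j) (hj : j < 2 * c₀) :
    IsZero (localHomologyOfSet R M N Z j) := by
  obtain ⟨i, rfl⟩ : ∃ i, j = i + 1 := ⟨j - 1, by omega⟩
  have hBA : Tᶜ ⊆ Zᶜ := compl_subset_compl.2 hZT
  -- the two neighbours in the exact sequence of the triple vanish
  have h₁ : IsZero (relativeSingularHomology R M N Tᶜ (i + 1)) :=
    hT.isZero_localHomologyOfSet R M hc₀ (by omega) hj
  have h₃ : IsZero (relativeSingularHomology R M (↥Zᶜ) (Subtype.val ⁻¹' Tᶜ) i) := by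
    rw [Set.preimage_compl]
    exact hT.isZero_localHomologyOfSet_preimage R M hc₀ hZ.isOpen_compl (by omega) (by omega)
  refine (relativeSingularHomology.triple_exact₃ R M (X := N) hBA i).isZero_of_both_zeros
    (h₁.eq_of_src _ _) (h₃.eq_of_tgt _ _)

end LocalHomology

end Literature.Geometry.Kaehler

end
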